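import Literature.MathematicalPhysics.QuantumFieldTheory.CCHS2024.Langevin2D
import Mathlib.Probability.Process.Stopping
import Mathlib.Probability.Independence.Basic
import Mathlib.MeasureTheory.Function.ConditionalExpectation.Basic
import HarnessLib

/-!
# Chandra–Chevyrev–Hairer–Shen: generative probability measures and the canonical Markov process
# on the space of gauge orbits `𝔒̂_α` (Publ. Math. IHÉS 136 (2022), Def. 2.11, Thm 2.13, §7.4)

Cross-ladder literature typing (R141 (D) item (5), fourth file; venue `CCHS2024/`). STATEMENTS ONLY —
hypothesis-free definitions and the printed theorems as named `Prop`s; nothing here is a claim about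
the Yang–Mills mass gap. Companion of `StateSpace2D.lean` (the state space `Ω¹_α`, the orbits
`[A]`, the metric `D_α` on `𝔒_α = Ω¹_α/𝔊^{0,α}`) and `Langevin2D.lean` (the renormalised SYM
equation (2.2), the mollified white noise, `(Ω¹_α)^sol`, the constant `C̄`). Source: A. Chandra,
I. Chevyrev, M. Hairer, H. Shen, *Langevin dynamic for the 2D Yang–Mills measure*, Publ. Math. IHÉS
136 (2022) 1–147, arXiv:2006.04987 (held `paper:arxiv-2006.04987`; bib
`ChandraChevyrevHairerShen2022YM2`). **Numbering.** As in the sibling files (published numbering =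
one shared counter per section): §2 = Thm 2.1, Rem 2.2–2.3, Thm 2.4, Rem 2.5–2.8, Thm 2.9, Rem 2.10,
Def 2.11, Rem 2.12, Thm 2.13; §7.4 ("Construction of the Markov process") opens with two lemmas,
here called Lemma 7.39 (Lipschitz bound for `inf_g |A^g|_α`, TeX label `lem:inf_Lip_cont`) and
Lemma 7.40 (measurable selection, `lem:selection`) — the numbers 7.39/7.40 are obtained by counting
the 40 numbered environments of §7 in the held text (Rem 7.1 … Prop 7.37, Rem 7.38, L 7.39, L 7.40)
and are cited together with the position "§7.4, first/second lemma"; §1.5.1's lemma characterising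
convergence in `F^sol` is cited by section.

## The printed statements

* **§2.2, before Def. 2.11.** `D_0(ℝ_+, X)` = functions `ℝ_+ → X` càdlàg on `(0,∞)` for which
  `A(0+)` exists; "white noise" = a pair of i.i.d. `𝔤`-valued white noises on `ℝ × 𝕋²`;
  `Ω̂¹_α = Ω¹_α ⊔ {☠}`, `𝔒̂_α = 𝔒_α ⊔ {☠}`, `π : Ω̂¹_α → 𝔒̂_α` the projection.
* **Definition 2.11 (generative).** A probability measure `μ` on `D_0(ℝ_+, Ω̂¹_α)` is *generative* if
  there exist a filtered probability space `(𝒪, 𝓕, (𝓕_t), 𝐏)` supporting a white noise `ξ` for which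
  `(𝓕_t)` is admissible (`ξ` adapted, `ξ↾[t,∞)` independent of `𝓕_t`), and a random variable
  `A : 𝒪 → D_0(ℝ_+, Ω̂¹_α)` such that: (1) `Law(A) = μ` and `A(0)` is `𝓕_0`-measurable; (2) there is an
  `𝓕_0`-measurable `g_0 : 𝒪 → 𝔊^{0,α}` with `A(0+) = A(0)^{g_0}` (`☠^g = ☠`); (3) with `Φ_{s,t}` the
  (random) solution map of the `ε → 0` limit of (2.2) with a non-anticipative mollifier `χ` and
  `C = C̄` (it exists and is `χ`-independent by Thm 2.9 (ii)), there is a non-decreasing sequence of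
  stopping times `σ_0 = 0 ≤ σ_1 ≤ …` with `A(t) = Φ_{σ_j,t}(A(σ_j+))` on `[σ_j, σ_{j+1})` and
  `A(σ_{j+1}) = Φ_{σ_j,σ_{j+1}}(A(σ_j+))^{g_{j+1}}` for an `𝓕_{σ_{j+1}}`-measurable
  `g_{j+1} : 𝒪 → 𝔊^{0,α}`; (4) with `T* = inf{t ≥ 0 : A(t) = ☠}`: a.s. `σ_j → T*`, and on `{T* < ∞}`
  a.s. `A ≡ ☠` on `[T*,∞)` and `lim_{t↑T*} inf_{g ∈ 𝔊^{0,α}} |A(t)^g|_α = ∞`. If `A(0) = a` a.s.,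
  `a` is the *initial condition* of `μ`.
* **Theorem 2.13.** (i) For every `a ∈ Ω̂¹_α` there exists a generative `μ` with initial condition `a`;
  one can take `(𝓕_t)` to be the filtration generated by any white noise and the process `A` itself
  to be Markov. (ii) There is a unique family of probability measures `{P^x}_{x ∈ 𝔒̂_α}` with
  `π_*μ = P^x` for every `x ∈ 𝔒̂_α`, `a ∈ x` and generative `μ` with initial condition `a`; moreover
  `{P^x}` are the transition probabilities of a time-homogeneous Markov process on `𝔒̂_α`. (Text
  before the theorem: `π_*μ` is a probability measure on `C(ℝ_+, 𝔒̂_α)`, indeed on `𝔒_α^sol` —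
  "the fact that this is the case is part of the following theorem".)
* **Lemma 7.39.** `α ∈ (2/3,1]`, `A, B ∈ Ω¹_α`:
  `|inf_{g∈𝔊^{0,α}} |B^g|_α − inf_{g∈𝔊^{0,α}} |A^g|_α| ≲ (1 + |A|_α + |B|_α)|A − B|_α`, the constant
  depending only on `α`. **Lemma 7.40.** `α ∈ (2/3,1)`: there is a Borel measurable selection
  `S : 𝔒_α → Ω¹_α` with `|S(x)|_α < 1 + inf_{A ∈ x} |A|_α` for all `x ∈ 𝔒_α`.

## What is typed (print → Lean)

* Ball-generated σ-algebras (the Borel structures print uses tacitly): `hatBorel` on `Ω̂¹_α`,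
  `alphaBorel` on `Ω¹_α`, `gaugeBorel` on `𝔊^{0,α}`, `orbitBorel` = pull-back of Borel(`𝔒_α`, `D_α`).
* §7.4: `orbitInfNorm` (`inf_{g ∈ 𝔊^{0,α}} |A^g|_α`), `hatOrbitInfNorm` (`= ∞` at `☠`); facts
  `orbitInfNorm_lipschitz` (L 7.39), `orbit_measurableSelection` (L 7.40).
* §2.2: `IsD0Path` (`D_0(ℝ_+, Ω̂¹_α)`), `blowUpTime` (`T*`), `atTime`, `topToENNReal`; constraints
  and cylinder events for `Ω̂¹_α`- and `𝔒̂_α`-valued processes (`InHatBall`, `InOrbitBall`,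
  `hatCylinder`, `orbitCylinder`, `hatOrbitEDist`, `SameOrbitHat`); the noise σ-algebras
  `noiseSigma` / `futureNoiseSigma` and `IsAdmissibleFiltration` (Mathlib `MeasureTheory.Filtration ℝ`,
  `ProbabilityTheory.Indep`); `IsLimitFlowFrom` (`Φ_{σ,·}(B)`); **`IsGenerative`** (Def. 2.11);
  `IsMarkovFor` (Markov property of `A` w.r.t. `(𝓕_t)`, Mathlib `condExp`).
* Facts: **`generative_exists`** (Thm 2.13 (i)) and **`markovProcessOnOrbits2D`** (Thm 2.13 (ii) with
  the `𝔒_α^sol` statement preceding the theorem).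

## Renderings (recorded for the reviewer)

* (R1)–(R4), (R7)–(R10) of the sibling files stay in force: `𝕋²` through its cover, matrices and
  `frobNorm`, the structure group through the tree's `LatticeRep`, `𝔤 = lieAlg r`; the white noise
  enters only through its family of mollifications `ζ^{χ,ε}` pinned down in joint law
  (`IsMollifiedWhiteNoise`); `(Ω¹_α)^sol`-paths are `ℝ → Option (LineFn N)` read on `t ≥ 0` with
  `none = ☠`. As in `Langevin2D.lean` the facts are stated for a compact SIMPLE structure group, for
  which print makes `C̄` explicit (`C̄ = λ·c_χ`, Rem. 2.10 / §7.3, `cbar`); Def. 2.11 is typed for an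
  arbitrary mollifier-dependent constant `Cof χ` and the facts instantiate `Cof χ = cbar λ χ · id`.
  -- TODO(general form): reductive `𝔤` (`C̄ ∈ L_G(𝔤,𝔤)` componentwise scalar, Rem. 2.8 and Rem. 2.10).
* (R16) **The solution map at random data.** Print evaluates the limiting random solution map
  `Φ_{s,t}` of (2.2) at a stopping time `σ_j` and an `𝓕_{σ_j}`-measurable datum `A(σ_j+)`. Here
  `Φ_{σ,σ+·}(B)` is typed DIRECTLY as the `ε ↓ 0` limit in probability, in `((Ω¹_α)^sol, D)`, of the
  maximal classical solutions of (2.2) driven by the mollified noise restarted at time `σ(ω)` from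
  `B(ω)` (`IsLimitFlowFrom`; `☠` from `☠` or from `σ = ∞`). For deterministic `(s, a)` this is print's
  `Φ_{s,·}(a)` (Thm 2.4 and stationarity of the noise); for a stopping time and an `𝓕_σ`-measurable
  datum it is the same object because, `(𝓕_t)` being admissible, the noise after `σ` is a white noise
  independent of `𝓕_σ` (conditioning on `𝓕_σ` and dominated convergence) — the identification print
  uses in Rem. 2.12 and in the proof of Thm 2.13 ("the law of `σ_{j+1} − σ_j` depends only on
  `A(σ_j+)`"). The quantifier over the mollifier in Def. 2.11 ("with a non-anticipative mollifier",
  footnote: `Φ` is independent of it) is rendered as `∃ χ`. Convergence in probability in `F^sol` does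
  not depend on the cut-off `ψ` entering `D` (§1.5.1, Lemma: `D(f_n,f) → 0` iff uniform convergence
  before the levels `T_L`), so `ψ` is universally quantified.
* (R17) **Admissible filtrations through mollifications.** `χ^ε(t,x) ≠ 0` forces `|t| < ε²/16`
  (support of `χ` in the parabolic ball of radius `¼`), so `ξ^{χ,ε}(s,x)` only involves the noise on
  `(s − ε²/16, s + ε²/16)`. "ξ adapted to `(𝓕_t)`" is typed as `𝒩_t ≤ 𝓕_t`, `𝒩_t` the σ-algebra
  generated by the `ζ^{χ,ε}_{i,n}(s,x)` with `s + ε²/16 ≤ t` (`noiseSigma`), and "`ξ↾[t,∞)`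
  independent of `𝓕_t`" as independence of `𝓕_t` from the σ-algebra generated by those with
  `s − ε²/16 ≥ t` (`futureNoiseSigma`); these generate the same σ-algebras as the white noise
  restricted to `(−∞,t]`, resp. `[t,∞)`, up to null sets. "The filtration generated by the white
  noise" (Thm 2.13 (i)) is `𝓕_t = 𝒩_t`.
* (R18) **Laws without measures on path space.** Def. 2.11 is typed for the PROCESS
  `(𝒪, 𝓕, 𝐏, ξ, A)` (`IsGenerative`) rather than for its law `μ`; "`π_*μ = P^x` only depends on
  `x ∋ a`" becomes equality of the probabilities of all cylinder events of the projected processes,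
  cylinders being finite conjunctions of constraints "`[A(t_k)]` lies in the open `D_α`-ball of radius
  `ρ_k` about `[B_k]`" or "`A(t_k) = ☠`" (`orbitCylinder`) — a π-system generating the Borel
  σ-algebra of the Polish space `𝔒̂_α` (topology of `F̂`: balls of `F` and complements of closed balls,
  §1.5.1; `𝔒_α` separable, Thm 3.45), hence law-determining; likewise measurability of `Ω̂¹_α`-,
  `𝔊^{0,α}`-valued random variables is measurability for the ball-generated σ-algebras (`hatBorel`,
  `gaugeBorel`; both spaces are separable). "`{P^x}` define the transition probabilities of a
  time-homogeneous Markov process" is typed as the Markov property of every projected generative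
  process w.r.t. its own past with transition law from `x = [b]` given by the projected law of any
  generative process started at `b` (well defined by the uniqueness clause); "the process `A` itself
  is Markov" (Thm 2.13 (i)) as `𝐏[1_Γ | 𝓕_s] = 𝐏[1_Γ | σ(A(s))]` for future cylinders `Γ`
  (`IsMarkovFor`, Mathlib `condExp`).
* (R19) Def. 2.11 (3) writes `A(t) = Φ_{σ_j,t}(A(σ_j+))` on the CLOSED-open interval `[σ_j,σ_{j+1})`,
  which at `t = σ_0 = 0` would read `A(0) = A(0+)` although (2) allows `A(0+) = A(0)^{g_0} ≠ A(0)`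
  (`A ∈ D_0` may jump at `0`); the typed clause uses the open interval `(σ_j, σ_{j+1})` together with
  the values at the times `σ_{j+1}` from (3b), the right limit at `0` from (2) and the càdlàg property —
  equivalent to print for `j ≥ 1` and the intended reading at `j = 0`. The datum `A(σ_j+)` is
  `A(0)^{g_0}` for `j = 0` and `A(σ_j)` for `j ≥ 1` (càdlàg). Classical well-posedness of the
  mollified equation (2.2) (smooth forcing) is presupposed exactly as in `localExistence2D`.

## Not transcribed

Theorem 2.9 (i) (the coupled systems (2.5) for `(B,g)` and (2.7) for `(Ā,ḡ)`, the reduced gauge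
group `𝔊̊^{0,α} ↪ C^{0,α}(𝕋², L(𝔤,𝔤)) × Ω¹_α` of §7.1 and convergence in `(Ω¹_α × 𝔊̊^{0,α})^sol`,
Prop. 7.37): the system (2.7) is driven by `χ^ε ∗ (1_{t<0}ξ + 1_{t≥0} ḡ ξ^δ ḡ⁻¹)`, `δ ↓ 0`, i.e. by
the un-mollified noise conjugated by an adapted process, which is not a functional of the datum
`ζ^{χ,ε}` of (R8); it stays quoted in `gaugeCovariantConstant_mollifierIndependent`. Remark 2.12
(adaptedness of `t ↦ Φ_{s,t}(B)`), the proofs of §7.4, and the 3D analogues (Invent. Math. 237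
(2024), Thm 1.9 / §7) are not transcribed. The author-stated open question of §1.3 answered by
Chevyrev–Shen (CPAM 79 (2026), arXiv:2302.12160: the YM measure on `𝕋²` is the unique invariant
probability measure of this Markov process, for their axis-parallel variant of `𝔒_α`, Rem. 2.11
there) concerns the object `markovProcessOnOrbits2D` describes; it is a different paper's theorem on
a different state space and is not typed here.
-/

noncomputable section

open MeasureTheory Filter Topology ProbabilityTheory
open scoped ENNReal NNReal

namespace Literature.MathematicalPhysics.QuantumFieldTheory.CCHS2024

open Literature.MathematicalPhysics.QuantumLattice (IsSimpleCompactGroup)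

/-! ### Ball-generated σ-algebras (the Borel structures of `Ω̂¹_α`, `Ω¹_α`, `𝔊^{0,α}`, `𝔒_α`) -/

section Sigma

variable {N : ℕ}

/-- The σ-algebra on `Ω̂¹_α = Ω¹_α ⊔ {☠}` generated by `{☠}` and the open balls
`{A : |A − B|_α < ρ}` — the Borel σ-algebra of `Ω̂¹_α` (the topology of `F̂` has as basis the balls of
`F` and the complements of closed balls; `Ω¹_α` is separable) (R18).
[cite: ChandraChevyrevHairerShen2022YM2, §1.5.1 (F̂ = F ⊔ {☠} and its topology) and Def. 2.11 (1) ("A(0) is 𝓕_0-measurable")] -/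
abbrev hatBorel (α : ℝ) : MeasurableSpace (Option (LineFn N)) :=
  MeasurableSpace.generateFrom
    ({{none}} ∪
      {S | ∃ (B : LineFn N) (ρ : ℝ),
        S = {x | ∃ A : LineFn N, x = some A ∧ alphaNorm α (A - B) < ENNReal.ofReal ρ}})

/-- The σ-algebra on `Ω¹_α` generated by the open `|·|_α`-balls (its Borel σ-algebra, `Ω¹_α` being a
separable Banach space). [cite: ChandraChevyrevHairerShen2022YM2, §7.4 Lemma 7.40 (second lemma of §7.4: "measurable (Borel) selection S : 𝔒_α → Ω¹_α")] -/
abbrev alphaBorel (α : ℝ) : MeasurableSpace (LineFn N) :=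
  MeasurableSpace.generateFrom
    {S | ∃ (B : LineFn N) (ρ : ℝ), S = {A | alphaNorm α (A - B) < ENNReal.ofReal ρ}}

variable {G : Type*} [Group G] [TopologicalSpace G] (r : LatticeRep G)

/-- The σ-algebra on gauge transformations generated by the open `C^α`-balls
`{g : |g − h|_{C^α} < ρ}` — the Borel σ-algebra of `𝔊^{0,α}` (separable: the closure of the smooth
maps) (R18). [cite: ChandraChevyrevHairerShen2022YM2, Def. 2.11 (2) ("an 𝓕_0-measurable random variable g_0 : 𝒪 → 𝔊^{0,α}") with §3.4 (the group 𝔊^α and its C^α distance)] -/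
abbrev gaugeBorel (α : ℝ) : MeasurableSpace (E2 → G) :=
  MeasurableSpace.generateFrom
    {S | ∃ (h : E2 → G) (ρ : ℝ), S = {g | gaugeDist r α g h < ENNReal.ofReal ρ}}

/-- The σ-algebra on `Ω¹_α` generated by the open `D_α`-balls `{B : D_α([B],[A₀]) < ρ}`, `A₀ ∈ Ω¹_α` — the
pull-back along `π : Ω¹_α → 𝔒_α` of the Borel σ-algebra of the Polish space `(𝔒_α, D_α)` (its open
sets are countable unions of balls, Thm 3.45). [cite: ChandraChevyrevHairerShen2022YM2, §7.4 Lemma 7.40 (second lemma of §7.4) with Def. 3.44 and Thm 3.45] -/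
abbrev orbitBorel (α : ℝ) : MeasurableSpace (LineFn r.N) :=
  MeasurableSpace.generateFrom
    {S | ∃ A₀ ∈ Omega1 r.lieAlg α, ∃ ρ : ℝ, S = {B | orbitEDist r α B A₀ < ENNReal.ofReal ρ}}

end Sigma

/-! ### §7.4: `inf_{g ∈ 𝔊^{0,α}} |A^g|_α`, Lemma 7.39, Lemma 7.40 -/

section InfNorm

variable {G : Type*} [Group G] [TopologicalSpace G] (r : LatticeRep G)

/-- `inf_{g ∈ 𝔊^{0,α}} |A^g|_α` — the `|·|_α`-size of the orbit `[A]` (`= inf_{B ∈ [A]} |B|_α`).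
[cite: ChandraChevyrevHairerShen2022YM2, Def. 2.11 (4) and §7.4 Lemma 7.39 (first lemma of §7.4)] -/
def orbitInfNorm (α : ℝ) (A : LineFn r.N) : ℝ≥0∞ :=
  ⨅ g ∈ LittleGaugeGroup r α, alphaNorm α (gaugeAct r g A)

/-- `inf_{g ∈ 𝔊^{0,α}} |A^g|_α` extended to `Ω̂¹_α` by `+∞` at `☠` (so that "`→ ∞`" statements read
uniformly). [cite: ChandraChevyrevHairerShen2022YM2, Def. 2.11 (4) (lim_{t↑T*} inf_g |A(t)^g|_α = ∞)] -/
def hatOrbitInfNorm (α : ℝ) (x : Option (LineFn r.N)) : ℝ≥0∞ :=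
  x.elim ∞ (orbitInfNorm r α)

/-- **Lemma 7.39 (first lemma of §7.4).** Let `α ∈ (2/3, 1]` and `A, B ∈ Ω¹_α` (`𝔤`-valued). Then
`|inf_{g ∈ 𝔊^{0,α}} |B^g|_α − inf_{g ∈ 𝔊^{0,α}} |A^g|_α| ≲ (1 + |A|_α + |B|_α) |A − B|_α`, where the
proportionality constant depends only on `α` (and the structure group).
[cite: ChandraChevyrevHairerShen2022YM2, §7.4 Lemma 7.39 (first lemma of §7.4, eq. (inf_Lip_cont))] -/
def orbitInfNorm_lipschitz : Prop :=
  ∀ (G : Type) [Group G] [TopologicalSpace G] [CompactSpace G] (r : LatticeRep G) (α : ℝ),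
    2 / 3 < α → α ≤ 1 →
    ∃ C : ℝ, 0 ≤ C ∧ ∀ A ∈ Omega1 r.lieAlg α, ∀ B ∈ Omega1 r.lieAlg α,
      abs ((orbitInfNorm r α B).toReal - (orbitInfNorm r α A).toReal) ≤
        C * (1 + (alphaNorm α A).toReal + (alphaNorm α B).toReal) * (alphaNorm α (A - B)).toReal

/-- **Lemma 7.40 (second lemma of §7.4; measurable selection).** Let `α ∈ (2/3, 1)`. There exists a
Borel measurable selection `S : 𝔒_α → Ω¹_α` with `|S(x)|_α < 1 + inf_{A ∈ x} |A|_α` for all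
`x ∈ 𝔒_α`. Typed on representatives: `S : Ω¹_α → Ω¹_α` constant on orbits with `S(A) ∈ [A]`, the bound,
and Borel measurability from `(𝔒_α, D_α)` to `(Ω¹_α, |·|_α)` as measurability between the
ball-generated σ-algebras on the subspace `Ω¹_α` (R18). (Proof in print: Kuratowski–Ryll-Nardzewski
selection on the open set `{|A|_α < 1 + inf_g |A^g|_α}`, using Lemma 7.39 and Lemma 3.40.)
[cite: ChandraChevyrevHairerShen2022YM2, §7.4 Lemma 7.40 (second lemma of §7.4)] -/
def orbit_measurableSelection : Prop :=
  ∀ (G : Type) [Group G] [TopologicalSpace G] [CompactSpace G] (r : LatticeRep G) (α : ℝ),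
    2 / 3 < α → α < 1 →
    ∃ S : LineFn r.N → LineFn r.N,
      (∀ A ∈ Omega1 r.lieAlg α, S A ∈ orbit r α A ∧ alphaNorm α (S A) < 1 + orbitInfNorm r α A) ∧
      (∀ A ∈ Omega1 r.lieAlg α, ∀ B ∈ orbit r α A, S B = S A) ∧
      ∀ U : Set (LineFn r.N), MeasurableSet[alphaBorel α] U →
        ∃ V : Set (LineFn r.N), MeasurableSet[orbitBorel r α] V ∧
          S ⁻¹' U ∩ Omega1 r.lieAlg α = V ∩ Omega1 r.lieAlg α

end InfNorm

/-! ### `D_0(ℝ_+, Ω̂¹_α)`, blow-up times, cylinder events -/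

section Paths

variable {N : ℕ}

/-- **`f ∈ D_0(ℝ_+, Ω̂¹_α)`**: `f` (read on `t ≥ 0`) is càdlàg on `(0, ∞)` for the metric `d̂` of
`Ω̂¹_α` (right-continuous with left limits; `d̂` from §1.5.1, `hatDist`) and the right limit
`f(0+) = lim_{t↓0} f(t)` exists. [cite: ChandraChevyrevHairerShen2022YM2, §2.2 (the space D_0(ℝ_+, X), before Def. 2.11)] -/
def IsD0Path (α : ℝ) (f : ℝ → Option (LineFn N)) : Prop :=
  (∃ y : Option (LineFn N), Tendsto (fun s => hatDist α (f s) y) (𝓝[>] 0) (𝓝 0)) ∧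
  ∀ t : ℝ, 0 < t →
    Tendsto (fun s => hatDist α (f s) (f t)) (𝓝[>] t) (𝓝 0) ∧
    ∃ y : Option (LineFn N), Tendsto (fun s => hatDist α (f s) y) (𝓝[<] t) (𝓝 0)

/-- The blow-up time `T*[f] = inf{t ≥ 0 : f(t) = ☠} ∈ [0, ∞]`. [cite: ChandraChevyrevHairerShen2022YM2, Def. 2.11 (4) (T* ≔ inf{t ≥ 0 : A(t) = ☠})] -/
def blowUpTime (f : ℝ → Option (LineFn N)) : ℝ≥0∞ :=
  ⨅ (t : ℝ) (_ : 0 ≤ t ∧ f t = none), ENNReal.ofReal t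

/-- The value `f(σ)` of a path at a possibly infinite time (`☠` at `σ = ∞`). [cite: ChandraChevyrevHairerShen2022YM2, Def. 2.11 (3) (A(σ_j+), A(σ_{j+1}))] -/
def atTime (f : ℝ → Option (LineFn N)) (σ : WithTop ℝ) : Option (LineFn N) :=
  WithTop.recTopCoe none (fun s : ℝ => f s) σ

/-- A possibly infinite time as an element of `[0, ∞]` (negative times, which do not occur, to `0`).
[cite: ChandraChevyrevHairerShen2022YM2, Def. 2.11 (4) (lim_{j→∞} σ_j = T*)] -/
def topToENNReal (σ : WithTop ℝ) : ℝ≥0∞ :=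
  WithTop.recTopCoe ∞ (fun s : ℝ => ENNReal.ofReal s) σ

/-- An elementary constraint on a point of `Ω̂¹_α`: `none` = "is `☠`"; `some (B, ρ)` = "lies in the open
ball `{A : |A − B|_α < ρ}`" (R18). [cite: ChandraChevyrevHairerShen2022YM2, §1.5.1 (topology of F̂: balls of F and complements of closed balls) and Thm 2.13 (i) ("the process A itself to be Markov")] -/
def InHatBall (α : ℝ) (x : Option (LineFn N)) (c : Option (LineFn N × ℝ)) : Prop :=
  c.elim (x = none) fun bρ => ∃ A : LineFn N, x = some A ∧ alphaNorm α (A - bρ.1) < ENNReal.ofReal bρ.2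

variable {Ω : Type*}

/-- The cylinder event "`A(t_k)` satisfies the constraint `c_k` for all `k`" of an `Ω̂¹_α`-valued
process (R18). [cite: ChandraChevyrevHairerShen2022YM2, Thm 2.13 (i) ("the process A itself to be Markov")] -/
def hatCylinder (α : ℝ) {n : ℕ} (t : Fin n → ℝ) (c : Fin n → Option (LineFn N × ℝ))
    (A : Ω → ℝ → Option (LineFn N)) : Set Ω :=
  {ω | ∀ k, InHatBall α (A ω (t k)) (c k)}

variable {G : Type*} [Group G] [TopologicalSpace G] (r : LatticeRep G)

/-- An elementary constraint on a point of `𝔒̂_α`: `none` = "is `☠`"; `some (B, ρ)` = "the orbit lies in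
the open `D_α`-ball of radius `ρ` about `[B]`" (on representatives, R18). [cite: ChandraChevyrevHairerShen2022YM2, Thm 2.13 (ii) (π_*μ = P^x on paths in 𝔒̂_α) with Def. 3.44 (D_α) and §1.5.1 (topology of F̂)] -/
def InOrbitBall (α : ℝ) (x : Option (LineFn r.N)) (c : Option (LineFn r.N × ℝ)) : Prop :=
  c.elim (x = none) fun bρ => ∃ A : LineFn r.N, x = some A ∧ orbitEDist r α A bρ.1 < ENNReal.ofReal bρ.2

/-- The cylinder event "`[A(t_k)]` satisfies the constraint `c_k` for all `k`" of the projected process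
`πA` (R18). [cite: ChandraChevyrevHairerShen2022YM2, Thm 2.13 (ii)] -/
def orbitCylinder (α : ℝ) {n : ℕ} (t : Fin n → ℝ) (c : Fin n → Option (LineFn r.N × ℝ))
    (A : Ω → ℝ → Option (LineFn r.N)) : Set Ω :=
  {ω | ∀ k, InOrbitBall r α (A ω (t k)) (c k)}

/-- The pseudometric of `𝔒̂_α` on representatives: `D_α` between two orbits, `0` between `☠` and `☠`,
`∞` between `☠` and an orbit (only its zero set and convergence to `0` are used).
[cite: ChandraChevyrevHairerShen2022YM2, §2.2 (π_*μ is a probability measure on C(ℝ_+, 𝔒̂_α)) with Def. 3.44] -/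
def hatOrbitEDist (α : ℝ) (x y : Option (LineFn r.N)) : ℝ≥0∞ :=
  x.elim (y.elim 0 fun _ => ∞) fun A => y.elim ∞ fun B => orbitEDist r α A B

/-- `a, a' ∈ Ω̂¹_α` project to the same point of `𝔒̂_α`: both `☠`, or `a' ∈ [a]`.
[cite: ChandraChevyrevHairerShen2022YM2, Thm 2.13 (ii) ("for every x ∈ 𝔒̂_α, a ∈ x")] -/
def SameOrbitHat (α : ℝ) (a a' : Option (LineFn r.N)) : Prop :=
  a.elim (a' = none) fun A => ∃ A' : LineFn r.N, a' = some A' ∧ A' ∈ orbit r α A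

end Paths

/-! ### Admissible filtrations (R17) and the solution map at random data (R16) -/

section Filtrations

variable {N : ℕ} {Ω : Type*} [MeasurableSpace Ω]

/-- Filtrations indexed by real times on the measurable space `Ω` (Mathlib's `Filtration ℝ`; only
times `t ≥ 0` matter). [cite: ChandraChevyrevHairerShen2022YM2, Def. 2.11 (a filtered probability space (𝒪, 𝓕, (𝓕_t)_{t≥0}, 𝐏))] -/
abbrev Filt (Ω : Type*) [m : MeasurableSpace Ω] : Type _ := Filtration ℝ m

/-- The time half-width `ε²/16` of the support of `χ^ε` (`χ` is supported in the parabolic ball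
`{√|t| + |x| < ¼}`) (R17). [cite: ChandraChevyrevHairerShen2022YM2, §1.5 (support of a mollifier in {z : |z| < ¼}) and §2.1 (χ^ε(t,x) = ε⁻⁴χ(ε⁻²t, ε⁻¹x))] -/
def mollTimeRadius (ε : ℝ) : ℝ := ε ^ 2 / 16

/-- `𝒩_t`: the σ-algebra generated by the mollified noise fields `ζ^{χ,ε}_{i,n}(s,x)` that only involve
the white noise up to time `t` (`s + ε²/16 ≤ t`) — "the filtration generated by the white noise" (R17).
[cite: ChandraChevyrevHairerShen2022YM2, Def. 2.11 (admissible filtration: "ξ is adapted to (𝓕_t)") and Thm 2.13 (i) ("the filtration generated by any white noise")] -/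
abbrev noiseSigma (ζ : NoiseFamily N Ω) (t : ℝ) : MeasurableSpace Ω :=
  ⨆ (χ : SpaceTime2 → ℝ) (ε : ℝ) (z : SpaceTime2) (i : Fin 2) (n : NoiseIdx N)
    (_ : IsSpaceTimeMollifier χ ∧ 0 < ε ∧ ε ≤ 1 ∧ z.1 + mollTimeRadius ε ≤ t),
    MeasurableSpace.comap (fun ω => ζ χ ε ω z i n) (inferInstance : MeasurableSpace ℝ)

/-- `𝒩⁺_t`: the σ-algebra generated by the mollified noise fields that only involve the white noise
after time `t` (`s − ε²/16 ≥ t`) — "`ξ↾[t,∞)`" (R17). [cite: ChandraChevyrevHairerShen2022YM2, Def. 2.11 ("ξ↾[t,∞) is independent of 𝓕_t for all t ≥ 0")] -/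
abbrev futureNoiseSigma (ζ : NoiseFamily N Ω) (t : ℝ) : MeasurableSpace Ω :=
  ⨆ (χ : SpaceTime2 → ℝ) (ε : ℝ) (z : SpaceTime2) (i : Fin 2) (n : NoiseIdx N)
    (_ : IsSpaceTimeMollifier χ ∧ 0 < ε ∧ ε ≤ 1 ∧ t ≤ z.1 - mollTimeRadius ε),
    MeasurableSpace.comap (fun ω => ζ χ ε ω z i n) (inferInstance : MeasurableSpace ℝ)

/-- **`(𝓕_t)` is admissible** for the white noise (given through its mollifications `ζ`, R8): the
noise is adapted (`𝒩_t ≤ 𝓕_t`) and its future after `t` is independent of `𝓕_t` under `P` (R17).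
[cite: ChandraChevyrevHairerShen2022YM2, Def. 2.11 ("the filtration (𝓕_t)_{t≥0} is admissible (i.e. ξ is adapted to (𝓕_t)_{t≥0} and ξ↾[t,∞) is independent of 𝓕_t for all t ≥ 0)")] -/
def IsAdmissibleFiltration (P : Measure Ω) (F : Filt Ω) (ζ : NoiseFamily N Ω) : Prop :=
  (∀ t : ℝ, noiseSigma ζ t ≤ F t) ∧ ∀ t : ℝ, Indep (futureNoiseSigma ζ t) (F t) P

variable {G : Type*} [Group G] [TopologicalSpace G] (r : LatticeRep G)

/-- **`Θ = Φ_{σ,σ+·}(B)`, the limiting solution map of (2.2) at random data (R16).** For a random time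
`σ` (values in `[0,∞]`) and a random datum `B ∈ Ω̂¹_α`: a.s. `Θ ≡ ☠` where `σ = ∞` or `B = ☠`, a.s.
`Θ ∈ (Ω¹_α)^sol` otherwise, and for EVERY version `X^ε` of the maximal classical solutions of the
mollified equation (2.2) (constant `C`, mollifier `χ`) driven by the noise restarted at time `σ`,
`(t,x) ↦ ξ^{χ,ε}(σ + t, x)`, from `X^ε(0) = B`, one has `X^ε → Θ` in probability in `((Ω¹_α)^sol, D)` as
`ε ↓ 0` (for every admissible cut-off `ψ` defining `D`).
[cite: ChandraChevyrevHairerShen2022YM2, Def. 2.11 (3) (Φ_{s,t}, "the (random) solution map in the ε → 0 limit of (2.2) with a non-anticipative mollifier χ and constant C = C̄") with Thm 2.4] -/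
def IsLimitFlowFrom (P : Measure Ω) (ζ : NoiseFamily r.N Ω) (χ : SpaceTime2 → ℝ)
    (C : Matrix (Fin r.N) (Fin r.N) ℂ →ₗ[ℝ] Matrix (Fin r.N) (Fin r.N) ℂ) (α : ℝ)
    (σ : Ω → WithTop ℝ) (B : Ω → Option (LineFn r.N)) (Θ : Ω → ℝ → Option (LineFn r.N)) : Prop :=
  (∀ᵐ ω ∂P, (σ ω = ⊤ ∨ B ω = none) → ∀ t : ℝ, 0 ≤ t → Θ ω t = none) ∧
  (∀ᵐ ω ∂P, σ ω ≠ ⊤ → B ω ≠ none → IsSolPath r.lieAlg α (Θ ω)) ∧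
  ∀ X : ℝ → Ω → ℝ → Option (LineFn r.N),
    (∀ ε : ℝ, 0 < ε → ε ≤ 1 → ∀ᵐ ω ∂P, ∀ (s : ℝ) (b : LineFn r.N),
        σ ω = (s : WithTop ℝ) → B ω = some b →
        IsSYMSolutionPath r C (fun z : SpaceTime2 => matrixNoise r ζ χ ε ω (s + z.1, z.2)) b α
          (X ε ω)) →
    ∀ ψ : ℝ → ℝ, IsAdmissibleCutoff ψ → ∀ δ : ℝ, 0 < δ →
      Tendsto (fun ε : ℝ => P {ω | σ ω ≠ ⊤ ∧ B ω ≠ none ∧ δ < solDist ψ α (X ε ω) (Θ ω)})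
        (𝓝[>] 0) (𝓝 0)

end Filtrations

/-! ### Definition 2.11 (generative) and the Markov property -/

section Generative

variable {G : Type*} [Group G] [TopologicalSpace G] (r : LatticeRep G)
variable {Ω : Type*} [MeasurableSpace Ω]

/-- **Definition 2.11 (generative), for the process.** `A : 𝒪 → D_0(ℝ_+, Ω̂¹_α)` on the filtered
probability space `(𝒪, 𝓕, (𝓕_t), P)` carrying the white noise `ξ` (through its mollifications `ζ`,
R8) is *generative* — i.e. its law `μ` is a generative probability measure witnessed by these data —
if `(𝓕_t)` is admissible for `ξ`, a.s. `A ∈ D_0(ℝ_+, Ω̂¹_α)`, and: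
(1) `A(0)` is `𝓕_0`-measurable; (2) there is an `𝓕_0`-measurable `g_0 : 𝒪 → 𝔊^{0,α}` with
`A(0+) = A(0)^{g_0}` (`☠^g = ☠`); (3) for some non-anticipative mollifier `χ` (the solution map is
independent of it, Thm 2.9 (ii)), with `Φ_{s,t}` the limiting solution map of (2.2) with `C = Cof χ`
(`= C̄(χ)` in the facts), there are non-decreasing stopping times `σ_0 = 0 ≤ σ_1 ≤ ⋯ ≤ ∞` such that for
all `j`: `A(t) = Φ_{σ_j,t}(A(σ_j+))` for `t ∈ (σ_j, σ_{j+1})` (R16, R19) and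
`A(σ_{j+1}) = Φ_{σ_j,σ_{j+1}}(A(σ_j+))^{g_{j+1}}` for an `𝓕_{σ_{j+1}}`-measurable `g_{j+1} : 𝒪 → 𝔊^{0,α}`;
(4) with `T* = inf{t ≥ 0 : A(t) = ☠}`: a.s. `σ_j → T*`, and if `T* < ∞` then `A ≡ ☠` on `[T*, ∞)` and
`lim_{t↑T*} inf_{g ∈ 𝔊^{0,α}} |A(t)^g|_α = ∞`.
[cite: ChandraChevyrevHairerShen2022YM2, Def. 2.11 (items 1–4)] -/
def IsGenerative (P : Measure Ω) (F : Filt Ω) (ζ : NoiseFamily r.N Ω)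
    (Cof : (SpaceTime2 → ℝ) → (Matrix (Fin r.N) (Fin r.N) ℂ →ₗ[ℝ] Matrix (Fin r.N) (Fin r.N) ℂ))
    (α : ℝ) (A : Ω → ℝ → Option (LineFn r.N)) : Prop :=
  IsMollifiedWhiteNoise r P ζ ∧ IsAdmissibleFiltration P F ζ ∧
  -- `A` is a `D_0(ℝ_+, Ω̂¹_α)`-valued random variable
  (∀ᵐ ω ∂P, IsD0Path α (A ω) ∧
    ∀ t : ℝ, 0 ≤ t → ∀ X : LineFn r.N, A ω t = some X → X ∈ Omega1 r.lieAlg α) ∧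
  -- (1) `A(0)` is `𝓕_0`-measurable
  Measurable[F 0, hatBorel α] (fun ω => A ω 0) ∧
  ∃ χ : SpaceTime2 → ℝ, IsSpaceTimeMollifier χ ∧ IsNonAnticipative χ ∧
  ∃ (g : ℕ → Ω → E2 → G) (σ : ℕ → Ω → WithTop ℝ) (Θ : ℕ → Ω → ℝ → Option (LineFn r.N)),
    -- (2) `g_0` is `𝓕_0`-measurable, `𝔊^{0,α}`-valued, and `A(0+) = A(0)^{g_0}`
    Measurable[F 0, gaugeBorel r α] (g 0) ∧ (∀ᵐ ω ∂P, g 0 ω ∈ LittleGaugeGroup r α) ∧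
    (∀ᵐ ω ∂P,
      Tendsto (fun s => hatDist α (A ω s) ((A ω 0).map (gaugeAct r (g 0 ω)))) (𝓝[>] 0) (𝓝 0)) ∧
    -- (3) stopping times `σ_0 = 0 ≤ σ_1 ≤ ⋯`
    (∀ j, IsStoppingTime F (σ j)) ∧
    (∀ᵐ ω ∂P, σ 0 ω = ((0 : ℝ) : WithTop ℝ) ∧ Monotone fun j => σ j ω) ∧
    (∀ j : ℕ,
      -- `Θ_j = Φ_{σ_j, σ_j + ·}(A(σ_j+))`, `A(σ_0+) = A(0)^{g_0}`, `A(σ_j+) = A(σ_j)` for `j ≥ 1`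
      IsLimitFlowFrom r P ζ χ (Cof χ) α (σ j)
        (fun ω => if j = 0 then (A ω 0).map (gaugeAct r (g 0 ω)) else atTime (A ω) (σ j ω))
        (Θ j) ∧
      -- (3a) `A(t) = Φ_{σ_j,t}(A(σ_j+))` for `σ_j < t < σ_{j+1}`
      (∀ᵐ ω ∂P, ∀ s t : ℝ, σ j ω = (s : WithTop ℝ) → s < t → (t : WithTop ℝ) < σ (j + 1) ω →
        A ω t = Θ j ω (t - s)) ∧
      -- (3b) `g_{j+1}` is `𝓕_{σ_{j+1}}`-measurable, `𝔊^{0,α}`-valued, and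
      --      `A(σ_{j+1}) = Φ_{σ_j,σ_{j+1}}(A(σ_j+))^{g_{j+1}}`
      (∃ h : IsStoppingTime F (σ (j + 1)),
        Measurable[h.measurableSpace, gaugeBorel r α] (g (j + 1))) ∧
      (∀ᵐ ω ∂P, g (j + 1) ω ∈ LittleGaugeGroup r α) ∧
      (∀ᵐ ω ∂P, ∀ s u : ℝ, σ j ω = (s : WithTop ℝ) → σ (j + 1) ω = (u : WithTop ℝ) →
        A ω u = (Θ j ω (u - s)).map (gaugeAct r (g (j + 1) ω)))) ∧
    -- (4) honest blow-up
    (∀ᵐ ω ∂P,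
      Tendsto (fun j => topToENNReal (σ j ω)) atTop (𝓝 (blowUpTime (A ω))) ∧
      (blowUpTime (A ω) < ∞ →
        (∀ t : ℝ, 0 ≤ t → blowUpTime (A ω) ≤ ENNReal.ofReal t → A ω t = none) ∧
        (0 < blowUpTime (A ω) →
          Tendsto (fun t : ℝ => hatOrbitInfNorm r α (A ω t))
            (𝓝[<] (blowUpTime (A ω)).toReal) (𝓝 ∞))))

variable {N : ℕ}

/-- **`A` is Markov with respect to `(𝓕_t)`** (for an `Ω̂¹_α`-valued process): for `s ≥ 0` and every
cylinder event `Γ` of `A` at times `≥ s`, `P[1_Γ | 𝓕_s] = P[1_Γ | σ(A(s))]` a.s. (cylinders form a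
π-system generating the future σ-algebra; `σ(A(s))` for the Borel structure `hatBorel`) (R18).
[cite: ChandraChevyrevHairerShen2022YM2, Thm 2.13 (i) ("and the process A itself to be Markov")] -/
def IsMarkovFor (P : Measure Ω) (F : Filt Ω) (α : ℝ) (A : Ω → ℝ → Option (LineFn N)) : Prop :=
  ∀ s : ℝ, 0 ≤ s → ∀ (n : ℕ) (t : Fin n → ℝ) (c : Fin n → Option (LineFn N × ℝ)), (∀ k, s ≤ t k) →
    P[(hatCylinder α t c A).indicator (fun _ => (1 : ℝ)) | F s] =ᵐ[P]
      P[(hatCylinder α t c A).indicator (fun _ => (1 : ℝ)) |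
        (hatBorel α).comap (fun ω => A ω s)]

end Generative

/-! ### Theorem 2.13 -/

section Theorems

/-- **Theorem 2.13 (i) (existence of generative measures).** Simple compact structure group `G`,
`λ` its adjoint Casimir scalar, `C̄(χ) = λ·c_χ` (Rem. 2.10), `α ∈ (2/3, 1)`. For every `a ∈ Ω̂¹_α` there
exists a generative probability measure `μ` with initial condition `a`; moreover one can take `(𝓕_t)`
to be the filtration generated by ANY white noise and the process `A` itself to be Markov: for every
probability space carrying the white noise (its mollifications `ζ`, R8), with `𝓕_t = 𝒩_t` its
filtration (R17), there is a generative process `A` (Def. 2.11 for `C = C̄(χ)`) with `A(0) = a` a.s.,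
which is Markov w.r.t. `(𝓕_t)`. [cite: ChandraChevyrevHairerShen2022YM2, Thm 2.13 (i) with Def. 2.11 and Rem. 2.10] -/
def generative_exists : Prop :=
  ∀ (G : Type) [Group G] [TopologicalSpace G] [CompactSpace G], IsSimpleCompactGroup G →
    ∀ (r : LatticeRep G) (lam : ℝ), IsAdCasimirScalar r lam → ∀ (α : ℝ), 2 / 3 < α → α < 1 →
    ∀ (Ω : Type) [MeasurableSpace Ω] (P : Measure Ω) [IsProbabilityMeasure P]
      (ζ : NoiseFamily r.N Ω), IsMollifiedWhiteNoise r P ζ →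
    ∀ F : Filt Ω, (∀ t : ℝ, F t = noiseSigma ζ t) →
    ∀ a : Option (LineFn r.N), (∀ X : LineFn r.N, a = some X → X ∈ Omega1 r.lieAlg α) →
      ∃ A : Ω → ℝ → Option (LineFn r.N),
        IsGenerative r P F ζ (fun χ => cbar lam χ • LinearMap.id) α A ∧
        (∀ᵐ ω ∂P, A ω 0 = a) ∧ IsMarkovFor P F α A

/-- **Theorem 2.13 (ii) (the canonical Markov process `{P^x}_{x ∈ 𝔒̂_α}` on gauge orbits)**, simple
compact `G`, `C̄(χ) = λ·c_χ`, `α ∈ (2/3, 1)`. (a) *Uniqueness of `π_*μ`:* if `A`, `A'` are generative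
processes (on any filtered probability spaces, driven by any white noises) with initial conditions
`a, a' ∈ Ω̂¹_α` projecting to the same `x ∈ 𝔒̂_α`, the projected processes `πA`, `πA'` have the same law
— all cylinder probabilities agree (R18); this defines `P^x`. (b) *`π_*μ` lives on `𝔒_α^sol`:* a.s.
`t ↦ [A(t)]` is `D_α`-continuous on `[0, T*)` and tends to `☠` in `𝔒̂_α` (`D_α([A(t)],[0]) → ∞`) as
`t ↑ T* < ∞`. (c) *`{P^x}` are the transition probabilities of a time-homogeneous Markov process on
`𝔒̂_α`:* for a generative `A` from `a`, `s ≥ 0`, a past cylinder `E` (times `≤ s`) and a future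
cylinder `Γ` (times `s + t_k`), `P(E ∩ Γ) = ∫_E P^{[A(s)]}(Γ at times t_k) dP`, where `P^{[b]}` is
computed from ANY generative process started at `b` (well defined by (a)).
[cite: ChandraChevyrevHairerShen2022YM2, Thm 2.13 (ii) with the paragraph preceding Thm 2.13 (π_*μ is a probability measure on C(ℝ_+, 𝔒̂_α), indeed on 𝔒_α^sol), Def. 2.11, Rem. 2.10] -/
def markovProcessOnOrbits2D : Prop :=
  ∀ (G : Type) [Group G] [TopologicalSpace G] [CompactSpace G], IsSimpleCompactGroup G →
    ∀ (r : LatticeRep G) (lam : ℝ), IsAdCasimirScalar r lam → ∀ (α : ℝ), 2 / 3 < α → α < 1 →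
    -- (a) `π_* μ` depends only on the orbit of the initial condition
    (∀ (Ω : Type) [MeasurableSpace Ω] (P : Measure Ω) [IsProbabilityMeasure P] (F : Filt Ω)
        (ζ : NoiseFamily r.N Ω) (A : Ω → ℝ → Option (LineFn r.N)) (a : Option (LineFn r.N))
        (Ω' : Type) [MeasurableSpace Ω'] (P' : Measure Ω') [IsProbabilityMeasure P'] (F' : Filt Ω')
        (ζ' : NoiseFamily r.N Ω') (A' : Ω' → ℝ → Option (LineFn r.N)) (a' : Option (LineFn r.N)),
      IsGenerative r P F ζ (fun χ => cbar lam χ • LinearMap.id) α A → (∀ᵐ ω ∂P, A ω 0 = a) →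
      IsGenerative r P' F' ζ' (fun χ => cbar lam χ • LinearMap.id) α A' → (∀ᵐ ω ∂P', A' ω 0 = a') →
      SameOrbitHat r α a a' →
      ∀ (n : ℕ) (t : Fin n → ℝ) (c : Fin n → Option (LineFn r.N × ℝ)), (∀ k, 0 ≤ t k) →
        P (orbitCylinder r α t c A) = P' (orbitCylinder r α t c A')) ∧
    -- (b) a.s. the projected path lies in `𝔒_α^sol`
    (∀ (Ω : Type) [MeasurableSpace Ω] (P : Measure Ω) [IsProbabilityMeasure P] (F : Filt Ω)
        (ζ : NoiseFamily r.N Ω) (A : Ω → ℝ → Option (LineFn r.N)),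
      IsGenerative r P F ζ (fun χ => cbar lam χ • LinearMap.id) α A →
      ∀ᵐ ω ∂P,
        (∀ t : ℝ, 0 ≤ t → A ω t ≠ none →
          Tendsto (fun s => hatOrbitEDist r α (A ω s) (A ω t)) (𝓝[Set.Ici 0] t) (𝓝 0)) ∧
        (blowUpTime (A ω) < ∞ → 0 < blowUpTime (A ω) →
          Tendsto (fun s : ℝ => hatOrbitEDist r α (A ω s) (some 0))
            (𝓝[<] (blowUpTime (A ω)).toReal) (𝓝 ∞))) ∧
    -- (c) `{P^x}` are the transition probabilities of a time-homogeneous Markov process on `𝔒̂_α`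
    (∀ (Ω : Type) [MeasurableSpace Ω] (P : Measure Ω) [IsProbabilityMeasure P] (F : Filt Ω)
        (ζ : NoiseFamily r.N Ω) (A : Ω → ℝ → Option (LineFn r.N)) (a : Option (LineFn r.N))
        -- a generative process from every starting point `b ∈ Ω̂¹_α` (they exist by part (i))
        (Ωf : Option (LineFn r.N) → Type) [∀ b, MeasurableSpace (Ωf b)]
        (Pf : ∀ b, Measure (Ωf b)) [∀ b, IsProbabilityMeasure (Pf b)] (Ff : ∀ b, Filt (Ωf b))
        (ζf : ∀ b, NoiseFamily r.N (Ωf b)) (Af : ∀ b, Ωf b → ℝ → Option (LineFn r.N)),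
      IsGenerative r P F ζ (fun χ => cbar lam χ • LinearMap.id) α A → (∀ᵐ ω ∂P, A ω 0 = a) →
      (∀ b : Option (LineFn r.N), (∀ X : LineFn r.N, b = some X → X ∈ Omega1 r.lieAlg α) →
        IsGenerative r (Pf b) (Ff b) (ζf b) (fun χ => cbar lam χ • LinearMap.id) α (Af b) ∧
          ∀ᵐ ω ∂(Pf b), Af b ω 0 = b) →
      ∀ (s : ℝ), 0 ≤ s →
      ∀ (m : ℕ) (u : Fin m → ℝ) (cu : Fin m → Option (LineFn r.N × ℝ)), (∀ k, 0 ≤ u k ∧ u k ≤ s) →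
      ∀ (n : ℕ) (t : Fin n → ℝ) (ct : Fin n → Option (LineFn r.N × ℝ)), (∀ k, 0 ≤ t k) →
        P (orbitCylinder r α u cu A ∩ orbitCylinder r α (fun k => s + t k) ct A) =
          ∫⁻ ω in orbitCylinder r α u cu A,
            (Pf (A ω s)) (orbitCylinder r α t ct (Af (A ω s))) ∂P)

end Theorems

end Literature.MathematicalPhysics.QuantumFieldTheory.CCHS2024
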